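import Literature.Geometry.Riemannian.MetricFlowConcentration
import Mathlib.MeasureTheory.Integral.MeanInequalities
import HarnessLib

/-!
# The triangle inequality for the variance of measures and the distance between two `H`-centres
# (Bamler 2020a, Lemma 3.2 (3.1); Bamler 2023, §2.2 Lemma and §3.4 Proposition)

R. Bamler, *Entropy and heat kernel bounds on a Ricci flow background*, arXiv:2008.07093 (2020a),
Lemma (Var triangle inequality), (3.1): for probability measures `μ₁, μ₂, μ₃` on a metric space,

  `√Var(μ₁, μ₃) ≤ √Var(μ₁, μ₂) + √Var(μ₂, μ₃)`,

proved there by integrating `d(x₁, x₃) ≤ d(x₁, x₂) + d(x₂, x₃)` over the triple product and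
applying Minkowski's inequality in `L²(μ₁ ⊗ μ₂ ⊗ μ₃)`; and Prop. (existence of `H_n`-centres),
second statement: two `H`-centres `z₁, z₂ ∈ 𝒳_s` of the same point `x ∈ 𝒳_t` satisfy
`d_s(z₁, z₂) ≤ 2 √(H (t − s))`. We prove both in the tree's vocabulary (`variance`,
`MetricFlow.IsHCenter` of `MetricFlowConcentration.lean`; square roots as `^(1/2)` on `ℝ≥0∞`):

* `sqrt_variance_triangle` — the triangle inequality (3.1);
* `MetricFlow.IsHCenter.edist_le_of_isHCenter` — `d_s(z₁, z₂) ≤ 2 (H(t − s))^{1/2}`.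

Everything is proved; no definitions, no named facts.

## References

* R. H. Bamler, *Entropy and heat kernel bounds on a Ricci flow background*, arXiv:2008.07093
  (2020), §3.1, Lemma 3.2 (3.1) and Prop. 3.12. [Bamler2020Entropy]
* R. H. Bamler, *Compactness theory of the space of super Ricci flows*, Invent. Math. 233 (2023),
  §2.2 (Lemma) and §3.4 (Proposition). [Bamler2023]
-/

noncomputable section

open Set MeasureTheory Filter TopologicalSpace Function
open scoped Topology ENNReal NNReal

namespace Literature.Geometry.Riemannian

section Triangle

variable {X : Type*} [MetricSpace X] [MeasurableSpace X] [BorelSpace X] [SeparableSpace X]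

/-- **Triangle inequality for the variance** (Bamler 2020a, (3.1); Bamler 2023, §2.2, Lemma):
`Var(μ₁, μ₃)^{1/2} ≤ Var(μ₁, μ₂)^{1/2} + Var(μ₂, μ₃)^{1/2}` for probability measures on a
separable metric space: on the probability space `(X³, μ₁ ⊗ μ₂ ⊗ μ₃)`,
`Var(μ₁, μ₃) = ‖d(x₁, x₃)‖₂²`, `d(x₁, x₃) ≤ d(x₁, x₂) + d(x₂, x₃)` and Minkowski's inequality,
with `‖d(x₁, x₂)‖₂² = Var(μ₁, μ₂)`, `‖d(x₂, x₃)‖₂² = Var(μ₂, μ₃)` (the extra variables integrate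
out). [cite: Bamler2020Entropy, §3.1, (3.1)] -/
theorem sqrt_variance_triangle (μ₁ μ₂ μ₃ : Measure X) [IsProbabilityMeasure μ₁]
    [IsProbabilityMeasure μ₂] [IsProbabilityMeasure μ₃] :
    (variance μ₁ μ₃) ^ (1 / 2 : ℝ) ≤
      (variance μ₁ μ₂) ^ (1 / 2 : ℝ) + (variance μ₂ μ₃) ^ (1 / 2 : ℝ) := by
  haveI : SecondCountableTopology X := UniformSpace.secondCountable_of_separable X
  -- the triple product `P = μ₁ ⊗ (μ₂ ⊗ μ₃)`, points `q = (x₁, (x₂, x₃))`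
  set P : Measure (X × (X × X)) := μ₁.prod (μ₂.prod μ₃) with hP
  -- the three distance functions on the triple product
  set f₁₃ : X × (X × X) → ℝ≥0∞ := fun q ↦ edist q.1 q.2.2 with hf₁₃
  set f₁₂ : X × (X × X) → ℝ≥0∞ := fun q ↦ edist q.1 q.2.1 with hf₁₂
  set f₂₃ : X × (X × X) → ℝ≥0∞ := fun q ↦ edist q.2.1 q.2.2 with hf₂₃
  have hm₁₃ : Measurable f₁₃ := measurable_fst.edist (measurable_snd.comp measurable_snd)
  have hm₁₂ : Measurable f₁₂ := measurable_fst.edist (measurable_fst.comp measurable_snd)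
  have hm₂₃ : Measurable f₂₃ :=
    (measurable_fst.comp measurable_snd).edist (measurable_snd.comp measurable_snd)
  -- the variances as integrals over the triple product
  have hsq : ∀ {f : X × (X × X) → ℝ≥0∞}, (fun q ↦ f q ^ (2 : ℝ)) = fun q ↦ f q ^ 2 := by
    intro f; funext q; rw [← ENNReal.rpow_natCast]; norm_num
  have hV₁₃ : variance μ₁ μ₃ = ∫⁻ q, f₁₃ q ^ (2 : ℝ) ∂P := by
    rw [hsq, variance_def, hP, lintegral_prod _ ((hm₁₃.pow_const 2).aemeasurable)]
    refine lintegral_congr fun x₁ ↦ ?_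
    rw [lintegral_prod _ (((measurable_const (a := x₁)).edist measurable_snd).pow_const 2).aemeasurable]
    simp [lintegral_const, measure_univ]
  have hV₁₂ : variance μ₁ μ₂ = ∫⁻ q, f₁₂ q ^ (2 : ℝ) ∂P := by
    rw [hsq, variance_def, hP, lintegral_prod _ ((hm₁₂.pow_const 2).aemeasurable)]
    refine lintegral_congr fun x₁ ↦ ?_
    rw [lintegral_prod _ (((measurable_const (a := x₁)).edist measurable_fst).pow_const 2).aemeasurable]
    simp [lintegral_const, measure_univ]
  have hV₂₃ : variance μ₂ μ₃ = ∫⁻ q, f₂₃ q ^ (2 : ℝ) ∂P := by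
    rw [hsq, variance_def, hP, lintegral_prod _ ((hm₂₃.pow_const 2).aemeasurable)]
    simp only [hf₂₃, lintegral_const, measure_univ, mul_one]
    rw [lintegral_prod _ ((measurable_fst.edist measurable_snd).pow_const 2).aemeasurable]
  -- pointwise triangle inequality and monotonicity of the `L²` norm
  have hle : ∀ q, f₁₃ q ≤ (f₁₂ + f₂₃) q := fun q ↦ edist_triangle _ _ _
  have hmono : (∫⁻ q, f₁₃ q ^ (2 : ℝ) ∂P) ^ (1 / 2 : ℝ) ≤
      (∫⁻ q, (f₁₂ + f₂₃) q ^ (2 : ℝ) ∂P) ^ (1 / 2 : ℝ) :=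
    ENNReal.rpow_le_rpow (lintegral_mono fun q ↦ ENNReal.rpow_le_rpow (hle q) (by norm_num))
      (by norm_num)
  -- Minkowski
  have hMink := ENNReal.lintegral_Lp_add_le (μ := P) hm₁₂.aemeasurable hm₂₃.aemeasurable
    (p := 2) (by norm_num)
  rw [hV₁₃, hV₁₂, hV₂₃]
  exact hmono.trans hMink

end Triangle

namespace MetricFlow

variable {I : Set ℝ} {𝒳 : MetricFlow I} {H : ℝ}

/-- **Two `H`-centres of the same point are `2√(H(t − s))`-close** (Bamler 2020a, Prop. 3.12,
second statement; Bamler 2023, §3.4): if `z₁, z₂ ∈ 𝒳_s` are `H`-centres of `x ∈ 𝒳_t`, then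
`d_s(z₁, z₂) ≤ 2 (H (t − s))^{1/2}` (`d_s(z₁, z₂) = Var(δ_{z₁}, δ_{z₂})^{1/2} ≤
Var(δ_{z₁}, ν_{x;s})^{1/2} + Var(ν_{x;s}, δ_{z₂})^{1/2}`, `sqrt_variance_triangle`).
[cite: Bamler2020Entropy, §3.1, Prop. 3.12] -/
theorem IsHCenter.edist_le_of_isHCenter {s t : I} {z₁ z₂ : 𝒳.Slice s} {x : 𝒳.Slice t}
    (h₁ : 𝒳.IsHCenter H z₁ x) (h₂ : 𝒳.IsHCenter H z₂ x) :
    edist z₁ z₂ ≤ 2 * (ENNReal.ofReal (H * ((t : ℝ) - s))) ^ (1 / 2 : ℝ) := by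
  haveI := 𝒳.isProbabilityMeasure_condKernel x h₁.1
  have htri := sqrt_variance_triangle (Measure.dirac z₁) (𝒳.condKernel x s) (Measure.dirac z₂)
  rw [variance_dirac_dirac] at htri
  have hpow : (edist z₁ z₂ ^ 2) ^ (1 / 2 : ℝ) = edist z₁ z₂ := by
    rw [← ENNReal.rpow_natCast, ← ENNReal.rpow_mul]; norm_num
  rw [hpow] at htri
  have hb₁ : (variance (Measure.dirac z₁) (𝒳.condKernel x s)) ^ (1 / 2 : ℝ) ≤
      (ENNReal.ofReal (H * ((t : ℝ) - s))) ^ (1 / 2 : ℝ) :=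
    ENNReal.rpow_le_rpow h₁.2 (by norm_num)
  have hb₂ : (variance (𝒳.condKernel x s) (Measure.dirac z₂)) ^ (1 / 2 : ℝ) ≤
      (ENNReal.ofReal (H * ((t : ℝ) - s))) ^ (1 / 2 : ℝ) := by
    rw [variance_comm]
    exact ENNReal.rpow_le_rpow h₂.2 (by norm_num)
  calc edist z₁ z₂ ≤ _ := htri
    _ ≤ (ENNReal.ofReal (H * ((t : ℝ) - s))) ^ (1 / 2 : ℝ) +
        (ENNReal.ofReal (H * ((t : ℝ) - s))) ^ (1 / 2 : ℝ) := add_le_add hb₁ hb₂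
    _ = 2 * (ENNReal.ofReal (H * ((t : ℝ) - s))) ^ (1 / 2 : ℝ) := by rw [two_mul]

end MetricFlow

end Literature.Geometry.Riemannian

end
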